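import Summits.Ventures.DiscreteObjects.Hadamard.ConferenceGraph333PGroupFixed

/-!
# Extremal fixed-point subgraphs of automorphisms of srg(333,166,82,83) are CONFERENCE GRAPHS:
# order 3 (f = 9), 27 ⇒ srg(9,4,1,2); order 5 (f = 13) ⇒ srg(13,6,2,3); orders 7, 11 (f = 25) ⇒ srg(25,12,5,6); order 41 ⇒ C₅ (kernel)

Framing: lottery ticket; floor = certified bounds/negative ranges.  Cell pub-namedobj (venture DiscreteObjects),
target (H) = `H(668)`, hadamard gen 30.  Structure theorems (no exclusion) sharpening the dictionary for the structured
families of FAMILY-Z166.md: with `F = Fix σ`, `deg_F ≡ 166`, `λ_F ≡ 82`, `μ_F ≡ 83 (mod p)` (gen 30,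
`ConferenceGraph333FixedSubgraph` / `…PGroupFixed`), plus two elementary eliminations —
* `fixed_deg_ne_one` — an `F`-degree `1` forces `p ∣ 82` (the edge has `λ_F = 0`): impossible for `p ∈ {3,5,7,11}`;
* `fixed_deg_le_sub_three` — an `F`-degree `≥ |F| − 2` forces `p ∣ 83` (`μ_F(x,z) = deg_F z` for the unique non-neighbour `z`,
  resp. `λ_F(x,y) = deg_F y − 1` when `x` sees all of `F`): impossible for `p ∈ {3,5,7,11}`;
the congruence windows collapse to single values and the fixed subgraph is an srg with conference parameters:
* **`aut_order3_fixed9_srg`** (`σ³ = 1`, `f = 9`): `deg_F = 4`, `Σ_{z∈F} A_xz A_zy = 2(1+[x=y]) − A_xy` — `srg(9,4,1,2)` (`K₃ □ K₃`);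
  **`aut_order27_fixed_srg`** (σ of order 27: `f = 9`, same conclusion via the `3`-group congruences);
* **`aut_order5_fixed13_srg`** (`σ⁵ = 1`, `f = 13`): `srg(13,6,2,3)` (Paley `P(13)`);
* **`aut_order11_fixed_srg`** (`σ¹¹ = 1`, `σ ≠ 1`; `f = 25` is forced): `srg(25,12,5,6)`; **`aut_order7_fixed25_srg`** (`σ⁷ = 1`, `f = 25`);
* **`aut_order41_fixed_srg`** (`σ⁴¹ = 1`, `σ ≠ 1`; `f = 5`): `deg_F = 2`, `λ_F = 0`, `μ_F = 1` — the pentagon `C₅`.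
(The case order 13, `f = 21 ⇒ srg(21,10,4,5)` is gen 30's exclusion `no_aut_order_13`.)  Method in print: Behbahani–Lam 2011
(orbit matrices / fixed subgraphs); instance and kernel proofs ours (PROVISIONAL).  WORDS: structure of a HYPOTHETICAL object.
No `sorry`, no new definitions.
-/

namespace Summit.Ventures.DiscreteObjects.Hadamard

open Finset

section fixedConference
variable {V : Type*} [Fintype V] [DecidableEq V]

omit [Fintype V] in
/-- (helper) all vertices of `F` other than `x` and at most one
exception are neighbours of `x`: from `Σ_{w ∈ F} A_xw ≥ |F| − 2`, for `w ∈ F`, `w ≠ x`, `w ≠ z` (`z` the possible exception with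
`A_xz = 0`) we get `A_xw = 1`. -/
theorem adj_of_deg_ge (A : Matrix V V ℤ) (h01 : ∀ x y, A x y = 0 ∨ A x y = 1) (hdiag : ∀ x, A x x = 0)
    (F : Finset V) {x z w : V} (hx : x ∈ F) (hz : z ∈ F) (hw : w ∈ F) (hzx : z ≠ x) (hwx : w ≠ x) (hwz : w ≠ z)
    (hAxz : A x z = 0) (hdeg : (F.card : ℤ) ≤ (∑ y ∈ F, A x y) + 2) : A x w = 1 := by
  rcases h01 x w with h0 | h1
  · exfalso
    have hle : ∀ y, A x y ≤ 1 := fun y => by rcases h01 x y with h | h <;> simp [h]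
    have hx' : x ∈ (F.erase w).erase z := Finset.mem_erase.mpr ⟨hzx.symm, Finset.mem_erase.mpr ⟨hwx.symm, hx⟩⟩
    have hz' : z ∈ F.erase w := Finset.mem_erase.mpr ⟨hwz.symm, hz⟩
    have e1 := Finset.sum_erase_add F (fun y => A x y) hw
    have e2 := Finset.sum_erase_add (F.erase w) (fun y => A x y) hz'
    have e3 := Finset.sum_erase_add ((F.erase w).erase z) (fun y => A x y) hx'
    have hb : ∑ y ∈ (((F.erase w).erase z).erase x), A x y ≤ ((((F.erase w).erase z).erase x).card : ℤ) := by
      have := Finset.sum_le_sum (s := ((F.erase w).erase z).erase x) (f := fun y => A x y) (g := fun _ => (1 : ℤ))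
        (fun y _ => hle y)
      simpa using this
    rw [Finset.card_erase_of_mem hx', Finset.card_erase_of_mem hz', Finset.card_erase_of_mem hw] at hb
    have hc3 : 3 ≤ F.card := by
      have : ({x, z, w} : Finset V) ⊆ F := by
        intro y hy; simp only [Finset.mem_insert, Finset.mem_singleton] at hy
        rcases hy with rfl | rfl | rfl <;> assumption
      have hc := Finset.card_le_card this
      rw [Finset.card_insert_of_notMem (by simp [hzx.symm, hwx.symm]),
        Finset.card_insert_of_notMem (by simp [hwz.symm]), Finset.card_singleton] at hc
      · exact hc
    push_cast [Nat.sub_sub, show 1 + 1 + 1 ≤ F.card by omega] at hb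
    rw [hdiag, h0, hAxz] at *
    linarith
  · exact h1

/-- **No `F`-degree `1`** when `p ∈ {3,5,7,11}`: the unique neighbour `y` would give `λ_F(x,y) = 0 ≡ 82 (mod p)`. -/
theorem fixed_deg_ne_one (A : Matrix V V ℤ) (h01 : ∀ x y, A x y = 0 ∨ A x y = 1) (hdiag : ∀ x, A x x = 0)
    (hsrg : ∀ x y, ∑ z, A x z * A z y = 83 * (1 + (if x = y then 1 else 0)) - A x y)
    {p : ℕ} (hp' : p = 3 ∨ p = 5 ∨ p = 7 ∨ p = 11) (F : Finset V)
    (hpair : ∀ x ∈ F, ∀ y ∈ F, ∃ b : ℤ, (∑ z ∈ F, A x z * A z y) + p * b = ∑ z, A x z * A z y)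
    {x : V} (hx : x ∈ F) (h1 : ∑ y ∈ F, A x y = 1) : False := by
  obtain ⟨y, hy, hAxy⟩ : ∃ y ∈ F, A x y = 1 := by
    by_contra hc
    push Not at hc
    have : ∑ y ∈ F, A x y = 0 := Finset.sum_eq_zero fun y hy => by
      rcases h01 x y with h | h
      · exact h
      · exact absurd h (hc y hy)
    omega
  have hxy : x ≠ y := by rintro rfl; rw [hdiag] at hAxy; norm_num at hAxy
  obtain ⟨b, hb⟩ := hpair x hx y hy
  rw [hsrg x y, if_neg hxy, hAxy] at hb
  obtain ⟨hl0, hl1⟩ := sum_adj_mul_bounds A h01 hdiag F x hy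
  rw [h1, hAxy] at hl1
  rcases hp' with rfl | rfl | rfl | rfl <;> push_cast at hb <;> omega

/-- **`F`-degrees are at most `|F| − 3`** when `p ∈ {3,5,7,11}` and `|F| ≥ 3`: a vertex adjacent to all but at most one other
vertex of `F` forces `p ∣ 83`. -/
theorem fixed_deg_le_sub_three (A : Matrix V V ℤ) (h01 : ∀ x y, A x y = 0 ∨ A x y = 1) (hsymm : ∀ x y, A y x = A x y)
    (hdiag : ∀ x, A x x = 0) (hk : ∀ x, ∑ y, A x y = 166)
    (hsrg : ∀ x y, ∑ z, A x z * A z y = 83 * (1 + (if x = y then 1 else 0)) - A x y)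
    {p : ℕ} (hp' : p = 3 ∨ p = 5 ∨ p = 7 ∨ p = 11) (F : Finset V) (hF3 : 3 ≤ F.card)
    (hrow : ∀ x ∈ F, ∃ a : ℤ, (∑ y ∈ F, A x y) + p * a = ∑ y, A x y)
    (hpair : ∀ x ∈ F, ∀ y ∈ F, ∃ b : ℤ, (∑ z ∈ F, A x z * A z y) + p * b = ∑ z, A x z * A z y)
    {x : V} (hx : x ∈ F) : (∑ y ∈ F, A x y) + 3 ≤ F.card := by
  by_contra hlt
  push Not at hlt
  have hdeg : (F.card : ℤ) ≤ (∑ y ∈ F, A x y) + 2 := by omega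
  -- pick z ∈ F, z ≠ x with A x z = 0 if the degree is |F| − 2, else any z ≠ x (degree |F| − 1)
  obtain ⟨h0, hdx⟩ := sum_adj_bounds A h01 hdiag F hx
  have hge : ∀ u w, 0 ≤ A u w := fun u w => by rcases h01 u w with h | h <;> simp [h]
  have hle : ∀ u w, A u w ≤ 1 := fun u w => by rcases h01 u w with h | h <;> simp [h]
  -- there is z ≠ x in F (|F| ≥ 3)
  obtain ⟨z, hz, hzx, hzmin⟩ : ∃ z ∈ F, z ≠ x ∧ ∀ w ∈ F, w ≠ x → A x z ≤ A x w := by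
    have hne : (F.erase x).Nonempty := by
      rw [← Finset.card_pos, Finset.card_erase_of_mem hx]; omega
    obtain ⟨z, hz, hmin⟩ := Finset.exists_min_image (F.erase x) (fun w => A x w) hne
    exact ⟨z, Finset.mem_of_mem_erase hz, Finset.ne_of_mem_erase hz,
      fun w hw hwx => hmin w (Finset.mem_erase.mpr ⟨hwx, hw⟩)⟩
  -- every w ∉ {x, z} in F is a neighbour of x
  have hall : ∀ w ∈ F, w ≠ x → w ≠ z → A x w = 1 := by
    intro w hw hwx hwz
    rcases h01 x z with hz0 | hz1
    · exact adj_of_deg_ge A h01 hdiag F hx hz hw hzx hwx hwz hz0 hdeg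
    · have := hzmin w hw hwx
      rw [hz1] at this
      rcases h01 x w with h | h
      · omega
      · exact h
  obtain ⟨a, ha⟩ := hrow z hz
  rw [hk z] at ha
  obtain ⟨b, hb⟩ := hpair x hx z hz
  rw [hsrg x z, if_neg hzx.symm] at hb
  -- the common-neighbour count of x and z inside F equals deg_F z − A z x·[..]: every neighbour w of z in F (w ≠ x) is a neighbour of x
  have hcod : ∑ w ∈ F, A x w * A w z = (∑ w ∈ F, A z w) - A x z := by
    rw [← Finset.sum_erase_add F (fun w => A x w * A w z) hx, ← Finset.sum_erase_add F (fun w => A z w) hx, hdiag x, zero_mul,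
      add_zero, hsymm x z]
    suffices h : ∑ w ∈ F.erase x, A x w * A w z = ∑ w ∈ F.erase x, A z w by rw [h]; ring
    refine Finset.sum_congr rfl fun w hw => ?_
    have hwx : w ≠ x := Finset.ne_of_mem_erase hw
    have hwF : w ∈ F := Finset.mem_of_mem_erase hw
    by_cases hwz : w = z
    · subst hwz; rw [hdiag, mul_zero]
    · rw [hall w hwF hwx hwz, one_mul, hsymm z w]
  rw [hcod] at hb
  rcases h01 x z with e | e <;> rw [e] at hb <;> rcases hp' with rfl | rfl | rfl | rfl <;> push_cast at ha hb <;> omega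

/-- Generic packaging: if every `F`-degree lies in `[2, |F| − 3]` and is `≡ 166 (mod p)`, the common-neighbour counts are
`≡ 82 / 83 (mod p)`, and these windows contain single values `k`, `l`, `m` (checked by `omega` in each instance), then `F`
induces an srg — used below through the concrete instances. -/
theorem fixed_srg_params (A : Matrix V V ℤ) (h01 : ∀ x y, A x y = 0 ∨ A x y = 1) (hsymm : ∀ x y, A y x = A x y)
    (hdiag : ∀ x, A x x = 0) (hk : ∀ x, ∑ y, A x y = 166)
    (hsrg : ∀ x y, ∑ z, A x z * A z y = 83 * (1 + (if x = y then 1 else 0)) - A x y)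
    {p : ℕ} (hp' : p = 3 ∨ p = 5 ∨ p = 7 ∨ p = 11) (F : Finset V) (hF3 : 3 ≤ F.card)
    (hrow : ∀ x ∈ F, ∃ a : ℤ, (∑ y ∈ F, A x y) + p * a = ∑ y, A x y)
    (hpair : ∀ x ∈ F, ∀ y ∈ F, ∃ b : ℤ, (∑ z ∈ F, A x z * A z y) + p * b = ∑ z, A x z * A z y)
    (k : ℤ) (hkuniq : ∀ d a : ℤ, 2 ≤ d → d + 3 ≤ F.card → d + p * a = 166 → d = k)
    (l m : ℤ) (hluniq : ∀ c b : ℤ, 0 ≤ c → c + 1 ≤ k → c + p * b = 82 → c = l)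
    (hmuniq : ∀ c b : ℤ, 0 ≤ c → c ≤ k → c + p * b = 83 → c = m) :
    (∀ x ∈ F, ∑ y ∈ F, A x y = k) ∧
    (∀ x ∈ F, ∀ y ∈ F, ∑ z ∈ F, A x z * A z y = (if x = y then k else if A x y = 1 then l else m)) := by
  have hdeg : ∀ x ∈ F, ∑ y ∈ F, A x y = k := by
    intro x hx
    obtain ⟨a, ha⟩ := hrow x hx
    rw [hk x] at ha
    have h3 := fixed_deg_le_sub_three A h01 hsymm hdiag hk hsrg hp' F hF3 hrow hpair hx
    have h2 : 2 ≤ ∑ y ∈ F, A x y := by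
      obtain ⟨h0, -⟩ := sum_adj_bounds A h01 hdiag F hx
      by_contra hlt
      have hne1 : ∑ y ∈ F, A x y ≠ 1 := fun h1 => fixed_deg_ne_one A h01 hdiag hsrg hp' F hpair hx h1
      -- degree 0: then μ(x, y) = 0 for some y ≠ x in F, forcing p ∣ 83
      have h0' : ∑ y ∈ F, A x y = 0 := by omega
      obtain ⟨y, hy, hyx⟩ : ∃ y ∈ F, y ≠ x := by
        have hne : (F.erase x).Nonempty := by rw [← Finset.card_pos, Finset.card_erase_of_mem hx]; omega
        obtain ⟨y, hy⟩ := hne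
        exact ⟨y, Finset.mem_of_mem_erase hy, Finset.ne_of_mem_erase hy⟩
      obtain ⟨b, hb⟩ := hpair x hx y hy
      obtain ⟨hl0, hl1⟩ := sum_adj_mul_bounds A h01 hdiag F x hy
      have hAxy : A x y = 0 := by
        have hge : ∀ w, 0 ≤ A x w := fun w => by rcases h01 x w with h | h <;> simp [h]
        have := Finset.single_le_sum (fun w _ => hge w) hy
        rcases h01 x y with h | h
        · exact h
        · simp only [h] at this; omega
      rw [hsrg x y, if_neg hyx.symm, hAxy] at hb
      rw [h0', hAxy] at hl1
      rcases hp' with rfl | rfl | rfl | rfl <;> push_cast at hb <;> omega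
    exact hkuniq _ a h2 h3 ha
  refine ⟨hdeg, fun x hx y hy => ?_⟩
  by_cases hxy : x = y
  · subst hxy
    rw [if_pos rfl, sum_adj_mul_self A h01 hsymm F x, hdeg x hx]
  · rw [if_neg hxy]
    obtain ⟨b, hb⟩ := hpair x hx y hy
    rw [hsrg x y, if_neg hxy] at hb
    obtain ⟨hl0, hl1⟩ := sum_adj_mul_bounds A h01 hdiag F x hy
    rw [hdeg x hx] at hl1
    rcases h01 x y with e | e
    · rw [e, if_neg (by norm_num)]
      rw [e] at hb hl1
      exact hmuniq _ b hl0 (by linarith) (by linarith)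
    · rw [e, if_pos rfl]
      rw [e] at hb hl1
      exact hluniq _ b hl0 (by linarith) (by linarith)

/-- **Order 3 with nine fixed points ⇒ the fixed subgraph is `srg(9,4,1,2)`** (`= K₃ □ K₃`, the Paley graph of order 9). -/
theorem aut_order3_fixed9_srg (A : Matrix V V ℤ)
    (h01 : ∀ x y, A x y = 0 ∨ A x y = 1) (hsymm : ∀ x y, A y x = A x y) (hdiag : ∀ x, A x x = 0)
    (hk : ∀ x, ∑ y, A x y = 166) (hsrg : ∀ x y, ∑ z, A x z * A z y = 83 * (1 + (if x = y then 1 else 0)) - A x y)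
    (σ : Equiv.Perm V) {e : ℕ} (hσ : σ ^ (3 ^ e) = 1) (hA : ∀ x y, A (σ x) (σ y) = A x y)
    (hf : (univ.filter fun x => σ x = x).card = 9) :
    (∀ x ∈ univ.filter (fun x => σ x = x), ∑ y ∈ univ.filter (fun x => σ x = x), A x y = 4) ∧
    (∀ x ∈ univ.filter (fun x => σ x = x), ∀ y ∈ univ.filter (fun x => σ x = x),
      ∑ z ∈ univ.filter (fun x => σ x = x), A x z * A z y = (if x = y then 4 else if A x y = 1 then 1 else 2)) := by
  have hp : Nat.Prime 3 := by norm_num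
  refine fixed_srg_params A h01 hsymm hdiag hk hsrg (Or.inl rfl) _ (by rw [hf]; norm_num)
    (fun x hx => aut_ppow_fixed_row_congr A h01 σ hp hσ hA (Finset.mem_filter.mp hx).2)
    (fun x hx y hy => aut_ppow_fixed_pair_congr A h01 σ hp hσ hA (Finset.mem_filter.mp hx).2 (Finset.mem_filter.mp hy).2)
    4 (fun d a h2 h3 h => by rw [hf] at h3; push_cast at h h3; omega) 1 2
    (fun c b h0 h1 h => by push_cast at h; omega) (fun c b h0 h1 h => by push_cast at h; omega)

/-- **Order 5 with thirteen fixed points ⇒ the fixed subgraph is `srg(13,6,2,3)`** (the Paley graph `P(13)`). -/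
theorem aut_order5_fixed13_srg (A : Matrix V V ℤ)
    (h01 : ∀ x y, A x y = 0 ∨ A x y = 1) (hsymm : ∀ x y, A y x = A x y) (hdiag : ∀ x, A x x = 0)
    (hk : ∀ x, ∑ y, A x y = 166) (hsrg : ∀ x y, ∑ z, A x z * A z y = 83 * (1 + (if x = y then 1 else 0)) - A x y)
    (σ : Equiv.Perm V) {e : ℕ} (hσ : σ ^ (5 ^ e) = 1) (hA : ∀ x y, A (σ x) (σ y) = A x y)
    (hf : (univ.filter fun x => σ x = x).card = 13) :
    (∀ x ∈ univ.filter (fun x => σ x = x), ∑ y ∈ univ.filter (fun x => σ x = x), A x y = 6) ∧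
    (∀ x ∈ univ.filter (fun x => σ x = x), ∀ y ∈ univ.filter (fun x => σ x = x),
      ∑ z ∈ univ.filter (fun x => σ x = x), A x z * A z y = (if x = y then 6 else if A x y = 1 then 2 else 3)) := by
  have hp : Nat.Prime 5 := by norm_num
  refine fixed_srg_params A h01 hsymm hdiag hk hsrg (Or.inr (Or.inl rfl)) _ (by rw [hf]; norm_num)
    (fun x hx => aut_ppow_fixed_row_congr A h01 σ hp hσ hA (Finset.mem_filter.mp hx).2)
    (fun x hx y hy => aut_ppow_fixed_pair_congr A h01 σ hp hσ hA (Finset.mem_filter.mp hx).2 (Finset.mem_filter.mp hy).2)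
    6 (fun d a h2 h3 h => by rw [hf] at h3; push_cast at h h3; omega) 2 3
    (fun c b h0 h1 h => by push_cast at h; omega) (fun c b h0 h1 h => by push_cast at h; omega)

/-- **Order 7 with twenty-five fixed points ⇒ the fixed subgraph is `srg(25,12,5,6)`.** -/
theorem aut_order7_fixed25_srg (A : Matrix V V ℤ)
    (h01 : ∀ x y, A x y = 0 ∨ A x y = 1) (hsymm : ∀ x y, A y x = A x y) (hdiag : ∀ x, A x x = 0)
    (hk : ∀ x, ∑ y, A x y = 166) (hsrg : ∀ x y, ∑ z, A x z * A z y = 83 * (1 + (if x = y then 1 else 0)) - A x y)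
    (σ : Equiv.Perm V) {e : ℕ} (hσ : σ ^ (7 ^ e) = 1) (hA : ∀ x y, A (σ x) (σ y) = A x y)
    (hf : (univ.filter fun x => σ x = x).card = 25) :
    (∀ x ∈ univ.filter (fun x => σ x = x), ∑ y ∈ univ.filter (fun x => σ x = x), A x y = 12) ∧
    (∀ x ∈ univ.filter (fun x => σ x = x), ∀ y ∈ univ.filter (fun x => σ x = x),
      ∑ z ∈ univ.filter (fun x => σ x = x), A x z * A z y = (if x = y then 12 else if A x y = 1 then 5 else 6)) := by
  have hp : Nat.Prime 7 := by norm_num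
  set F := univ.filter (fun x => σ x = x) with hF
  have hrow := fun x (hx : x ∈ F) => aut_ppow_fixed_row_congr A h01 σ hp hσ hA (Finset.mem_filter.mp hx).2
  have hpair := fun x (hx : x ∈ F) y (hy : y ∈ F) =>
    aut_ppow_fixed_pair_congr A h01 σ hp hσ hA (Finset.mem_filter.mp hx).2 (Finset.mem_filter.mp hy).2
  have hge : ∀ u w, 0 ≤ A u w := fun u w => by rcases h01 u w with h | h <;> simp [h]
  have hle : ∀ u w, A u w ≤ 1 := fun u w => by rcases h01 u w with h | h <;> simp [h]
  have hrowF : ∀ x ∈ F, ∃ a : ℤ, (∑ y ∈ F, A x y) + (7 : ℕ) * a = ∑ y, A x y := fun x hx => by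
    have := hrow x hx; rwa [← hF] at this
  have hpairF : ∀ x ∈ F, ∀ y ∈ F, ∃ b : ℤ, (∑ z ∈ F, A x z * A z y) + (7 : ℕ) * b = ∑ z, A x z * A z y :=
    fun x hx y hy => by have := hpair x hx y hy; rwa [← hF] at this
  -- degrees lie in {12, 19}: ≡ 5 (mod 7), in [2, 22], and 5 is excluded by λ ≡ 5 (mod 7) ≤ 4
  have hbasic : ∀ x ∈ F, ∑ y ∈ F, A x y = 12 ∨ ∑ y ∈ F, A x y = 19 := by
    intro x hx
    obtain ⟨a, ha⟩ := hrowF x hx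
    rw [hk x] at ha
    have h3 := fixed_deg_le_sub_three A h01 hsymm hdiag hk hsrg (Or.inr (Or.inr (Or.inl rfl))) F (by rw [hf]; norm_num)
      hrowF hpairF hx
    rw [hf] at h3
    obtain ⟨h0, -⟩ := sum_adj_bounds A h01 hdiag F hx
    push_cast at ha h3
    have hd : ∑ y ∈ F, A x y = 5 ∨ ∑ y ∈ F, A x y = 12 ∨ ∑ y ∈ F, A x y = 19 := by omega
    rcases hd with h5 | h12 | h19
    · exfalso
      obtain ⟨y, hy, hAxy⟩ : ∃ y ∈ F, A x y = 1 := by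
        by_contra hc; push Not at hc
        have : ∑ y ∈ F, A x y = 0 := Finset.sum_eq_zero fun y hy => by
          rcases h01 x y with h | h
          · exact h
          · exact absurd h (hc y hy)
        omega
      have hxy : x ≠ y := by rintro rfl; rw [hdiag] at hAxy; norm_num at hAxy
      obtain ⟨b, hb⟩ := hpairF x hx y hy
      rw [hsrg x y, if_neg hxy, hAxy] at hb
      obtain ⟨hl0, hl1⟩ := sum_adj_mul_bounds A h01 hdiag F x hy
      rw [h5, hAxy] at hl1
      push_cast at hb; omega
    · exact Or.inl h12
    · exact Or.inr h19
  -- degree 19 is impossible: a non-neighbour z has μ(x,z) ≥ 19 + deg z − 23 and ≤ 19, ≡ 6 (mod 7), deg z ∈ {12, 19}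
  have hdeg12 : ∀ x ∈ F, ∑ y ∈ F, A x y = 12 := by
    intro x hx
    rcases hbasic x hx with h12 | h19
    · exact h12
    exfalso
    obtain ⟨z, hz, hzx, hAxz⟩ : ∃ z ∈ F, z ≠ x ∧ A x z = 0 := by
      by_contra hc; push Not at hc
      have hall1 : ∀ y ∈ F.erase x, A x y = 1 := fun y hy => by
        rcases h01 x y with h | h
        · exact absurd h (hc y (Finset.mem_of_mem_erase hy) (Finset.ne_of_mem_erase hy))
        · exact h
      have e1 := Finset.sum_erase_add F (fun y => A x y) hx
      rw [hdiag, add_zero, Finset.sum_congr rfl hall1, Finset.sum_const, nsmul_eq_mul, mul_one,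
        Finset.card_erase_of_mem hx, hf] at e1
      push_cast at e1; omega
    obtain ⟨b, hb⟩ := hpairF x hx z hz
    rw [hsrg x z, if_neg hzx.symm, hAxz] at hb
    obtain ⟨hl0, hl1⟩ := sum_adj_mul_bounds A h01 hdiag F x hz
    rw [h19, hAxz] at hl1
    have hxz' : z ∈ F.erase x := Finset.mem_erase.mpr ⟨hzx, hz⟩
    have hlow : ∑ w ∈ (F.erase x).erase z, (A x w + A w z - 1) ≤ ∑ w ∈ F, A x w * A w z :=
      calc ∑ w ∈ (F.erase x).erase z, (A x w + A w z - 1) ≤ ∑ w ∈ (F.erase x).erase z, A x w * A w z :=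
            Finset.sum_le_sum fun w _ => by nlinarith [hge x w, hle x w, hge w z, hle w z]
        _ ≤ ∑ w ∈ F, A x w * A w z := Finset.sum_le_sum_of_subset_of_nonneg
            ((Finset.erase_subset _ _).trans (Finset.erase_subset _ _)) (fun w _ _ => mul_nonneg (hge x w) (hge w z))
    have hsx : ∑ w ∈ (F.erase x).erase z, A x w = 19 := by
      have e1 := Finset.sum_erase_add F (fun w => A x w) hx
      have e2 := Finset.sum_erase_add (F.erase x) (fun w => A x w) hxz'
      rw [hdiag] at e1; rw [hAxz] at e2; linarith
    have hsz : ∑ w ∈ (F.erase x).erase z, A w z = ∑ w ∈ F, A z w := by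
      have e1 := Finset.sum_erase_add F (fun w => A w z) hx
      have e2 := Finset.sum_erase_add (F.erase x) (fun w => A w z) hxz'
      rw [hAxz] at e1; rw [hdiag] at e2
      rw [← Finset.sum_congr rfl fun w _ => hsymm z w]; linarith
    have hcard : ((F.erase x).erase z).card = 23 := by
      rw [Finset.card_erase_of_mem hxz', Finset.card_erase_of_mem hx, hf]
    rw [Finset.sum_sub_distrib, Finset.sum_add_distrib, Finset.sum_const, hcard, hsx, hsz] at hlow
    norm_num at hlow
    -- μ(x,z) ≤ deg z
    obtain ⟨-, hl2⟩ := sum_adj_mul_bounds A h01 hdiag F z hx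
    have hμ : ∑ w ∈ F, A z w * A w x = ∑ w ∈ F, A x w * A w z :=
      Finset.sum_congr rfl fun w _ => by rw [hsymm w z, hsymm x w, mul_comm]
    rw [hμ, hsymm x z, hAxz] at hl2
    push_cast at hb
    rcases hbasic z hz with hz12 | hz19
    · rw [hz12] at hlow hl2; omega
    · rw [hz19] at hlow hl2; omega
  refine ⟨hdeg12, fun x hx y hy => ?_⟩
  by_cases hxy : x = y
  · subst hxy; rw [if_pos rfl, sum_adj_mul_self A h01 hsymm F x, hdeg12 x hx]
  · rw [if_neg hxy]
    obtain ⟨b, hb⟩ := hpairF x hx y hy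
    rw [hsrg x y, if_neg hxy] at hb
    obtain ⟨hl0, hl1⟩ := sum_adj_mul_bounds A h01 hdiag F x hy
    rw [hdeg12 x hx] at hl1
    rcases h01 x y with e | e
    · rw [e, if_neg (by norm_num)]; rw [e] at hb hl1; push_cast at hb; omega
    · rw [e, if_pos rfl]; rw [e] at hb hl1; push_cast at hb; omega

/-- **Order 11 ⇒ the 25 fixed points induce an `srg(25,12,5,6)`.** -/
theorem aut_order11_fixed_srg (hV : Fintype.card V = 333) (A : Matrix V V ℤ)
    (h01 : ∀ x y, A x y = 0 ∨ A x y = 1) (hsymm : ∀ x y, A y x = A x y) (hdiag : ∀ x, A x x = 0)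
    (hk : ∀ x, ∑ y, A x y = 166) (hsrg : ∀ x y, ∑ z, A x z * A z y = 83 * (1 + (if x = y then 1 else 0)) - A x y)
    (σ : Equiv.Perm V) (hσ : σ ^ 11 = 1) (hσ1 : σ ≠ 1) (hA : ∀ x y, A (σ x) (σ y) = A x y) :
    (univ.filter fun x => σ x = x).card = 25 ∧
    (∀ x ∈ univ.filter (fun x => σ x = x), ∑ y ∈ univ.filter (fun x => σ x = x), A x y = 12) ∧
    (∀ x ∈ univ.filter (fun x => σ x = x), ∀ y ∈ univ.filter (fun x => σ x = x),
      ∑ z ∈ univ.filter (fun x => σ x = x), A x z * A z y = (if x = y then 12 else if A x y = 1 then 5 else 6)) := by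
  have hp : Nat.Prime 11 := by norm_num
  have hf := aut_order11_fixed hV A h01 hsymm hdiag hk hsrg σ hσ hσ1 hA
  refine ⟨hf, fixed_srg_params A h01 hsymm hdiag hk hsrg (Or.inr (Or.inr (Or.inr rfl))) _ (by rw [hf]; norm_num)
    (fun x hx => aut_ppow_fixed_row_congr A h01 σ hp (e := 1) (by simpa using hσ) hA (Finset.mem_filter.mp hx).2)
    (fun x hx y hy => aut_ppow_fixed_pair_congr A h01 σ hp (e := 1) (by simpa using hσ) hA (Finset.mem_filter.mp hx).2
      (Finset.mem_filter.mp hy).2)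
    12 (fun d a h2 h3 h => by rw [hf] at h3; push_cast at h h3; omega) 5 6
    (fun c b h0 h1 h => by push_cast at h; omega) (fun c b h0 h1 h => by push_cast at h; omega)⟩

/-- **Order 41 ⇒ the five fixed points induce a pentagon `C₅ = srg(5,2,0,1)`.** -/
theorem aut_order41_fixed_srg (hV : Fintype.card V = 333) (A : Matrix V V ℤ)
    (h01 : ∀ x y, A x y = 0 ∨ A x y = 1) (hsymm : ∀ x y, A y x = A x y) (hdiag : ∀ x, A x x = 0)
    (hk : ∀ x, ∑ y, A x y = 166) (hsrg : ∀ x y, ∑ z, A x z * A z y = 83 * (1 + (if x = y then 1 else 0)) - A x y)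
    (σ : Equiv.Perm V) (hσ : σ ^ 41 = 1) (hσ1 : σ ≠ 1) (hA : ∀ x y, A (σ x) (σ y) = A x y) :
    (univ.filter fun x => σ x = x).card = 5 ∧
    (∀ x ∈ univ.filter (fun x => σ x = x), ∑ y ∈ univ.filter (fun x => σ x = x), A x y = 2) ∧
    (∀ x ∈ univ.filter (fun x => σ x = x), ∀ y ∈ univ.filter (fun x => σ x = x),
      ∑ z ∈ univ.filter (fun x => σ x = x), A x z * A z y = (if x = y then 2 else if A x y = 1 then 0 else 1)) := by
  have hp : Nat.Prime 41 := by norm_num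
  obtain ⟨-, -, -, -, -, -, -, -, w41, -⟩ :=
    aut_prime_windows_refined hV A h01 hsymm hdiag hk hsrg hp (by norm_num) σ hσ hσ1 hA
  have hf : (univ.filter fun x => σ x = x).card = 5 := w41 rfl
  set F := univ.filter (fun x => σ x = x) with hF
  have hdeg : ∀ x ∈ F, ∑ y ∈ F, A x y = 2 := by
    intro x hx
    obtain ⟨a, ha⟩ := aut_fixed_row_congr A hp σ hσ hA (Finset.mem_filter.mp hx).2
    rw [← hF, hk x] at ha
    obtain ⟨h0, h1⟩ := sum_adj_bounds A h01 hdiag F hx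
    rw [hf] at h1
    push_cast at ha h1
    omega
  refine ⟨hf, hdeg, fun x hx y hy => ?_⟩
  by_cases hxy : x = y
  · subst hxy; rw [if_pos rfl, sum_adj_mul_self A h01 hsymm F x, hdeg x hx]
  · rw [if_neg hxy]
    obtain ⟨b, hb⟩ := aut_fixed_pair_congr A hp σ hσ hA (Finset.mem_filter.mp hx).2 (Finset.mem_filter.mp hy).2
    rw [← hF, hsrg x y, if_neg hxy] at hb
    obtain ⟨hl0, hl1⟩ := sum_adj_mul_bounds A h01 hdiag F x hy
    rw [hdeg x hx] at hl1
    rcases h01 x y with e | e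
    · rw [e, if_neg (by norm_num)]; rw [e] at hb hl1; push_cast at hb; omega
    · rw [e, if_pos rfl]; rw [e] at hb hl1; push_cast at hb; omega

end fixedConference

end Summit.Ventures.DiscreteObjects.Hadamard
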